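import Mathlib.NumberTheory.Padics.ProperSpace
import Mathlib.Topology.MetricSpace.Ultra.TotallySeparated
import Literature.AnabelianGeometry.AbsoluteAnabelian.FreeProfiniteContinuousH2
import Literature.AnabelianGeometry.AbsoluteAnabelian.AbsTopIII.GeometricCyclotomeSyncInstanceClass
import HarnessLib

/-!
# [AbsTopIII] Prop. 1.4 (ii) at the instance class WITH THE PRINT'S INPUT "`Δ_{U_x}` is free profinite" ([AbsTopI] Lem. 4.5 (i))

Mochizuki, *Topics in Absolute Anabelian Geometry III*, §1, Prop. 1.4 (ii), manuscript pp. 31–32 (lit key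
`paper:url-5493eb38cbb7`): the differential `Hom(I_x, Λ) → H²(Δ_X, Λ)` of
`1 → I_x → Δ^{c-cn}_{U_x} → Δ_X → 1` "corresponds to the natural isomorphism `M_X ⥲ I_x`".  abc-iut-L4-t1's
named facts `CurveModel.Prop_1_4_ii_transgression M` (FACT-LIST F-0338; bijectivity of the differential
`ccnTransgression`) and `CurveModel.Prop_1_4_ii_sync M` (F-0365; the `∃`-form) were PROVED at the printed
instance class by abc-iut-f-076 / abc-iut-f-082 (`CcnTransgressionSurjective.lean` p432607,
`GeometricCyclotomeSyncInstanceClass.lean` p433130) modulo three structural inputs on the model, one of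
which was the opaque cohomological binder `Subsingleton (geomH2 (M.ext U_x) Ẑ)` ("`H²(Δ_{U_x}, Ẑ) = 0`").

This proof-only file (no definitions, no new named facts) REPLACES that binder by the print's own input —
[AbsTopI] Lem. 4.5 (i) p. 54: for AFFINE `U` "every torsion-free pro-`Σ` open subgroup of `Δ` is free
pro-`Σ`", in particular `Δ_{U_x}` is FREE PROFINITE (abc-iut-L4-t4's `IsFreePro (M.ext U_x).geom Set.univ`,
the right-hand-side vocabulary of `CuspidalData.NonProperIffFree`, F-0208) — using the kernel theorem
`IsFreePro.subsingleton_continuousCohomology_two` (`FreeProfiniteContinuousH2.lean`: a free profinite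
group of finite rank has `H²_cont = 0` with compact totally disconnected coefficients, cd `≤ 1`):

* `subsingleton_geomH2_of_isFreePro` — `H²(Δ, Λ) = 0` for every extension `1 → Δ → Π → G → 1` whose `Δ`
  is free pro-`Σ` of finite rank for a `Σ` containing all primes (i.e. free profinite) and every compact
  totally disconnected `Λ` (e.g. `Λ = ZHatCoeff = Ẑ`);
* `CurveModel.prop_1_4_ii_transgression_of_isFreePro` — **F-0338 `Prop_1_4_ii_transgression M` for every
  model all of whose cyclotome presentations have `Δ_{U_x} ↠ Δ_X`, `I_x ≤ [Δ_{U_x}, Δ_{U_x}]⁻` and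
  `Δ_{U_x}` FREE PROFINITE**; `…_of_prop_1_4_i'_of_isFreePro` — the surjection supplied by the named fact
  `Prop_1_4_i'` (F-0340, BY NAME; `CurveModel.surjOn_geom_res`);
* `CurveModel.prop_1_4_ii_sync_of_isFreePro`, `…_of_prop_1_4_i'_of_isFreePro` — the same upgrade for
  F-0365 over abc-iut-f-082's `prop_1_4_ii_sync_of_surjOn`.

What remains structural (transparent, what the geometry of a once-punctured proper curve gives in print):
`Δ_{U_x} ↠ Δ_X` (or F-0340) and `I_x ≤ [Δ_{U_x}, Δ_{U_x}]⁻` (one puncture: `Δ_{U_x}^{ab} = Δ_X^{ab}`).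
HONEST FRAMING: refereed pre-IUT material plus classical profinite group theory; a FACT row is an assumption
label, proved = OUR kernel check at the stated instance class; nothing here bears on [IUTchIII] Cor. 3.12;
typed ≠ proved.
-/

noncomputable section

open CategoryTheory

universe u

namespace Literature.AnabelianGeometry.AbsoluteAnabelian.AbsTopIII

/-- **`H²(Δ_X, Λ) = 0` when `Δ_X` is free profinite of finite rank** (e.g. `X` an AFFINE hyperbolic curve,
[AbsTopI] Lem. 4.5 (i)): for an extension `E = (1 → Δ → Π → G → 1)` with `IsFreePro E.geom Set.univ` and any
compact totally disconnected coefficient group `Λ`, abc-iut-L4-t1's `geomH2 E Λ` (Mathlib's continuous `H²`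
of the trivial `Δ`-module `Λ`) is a subsingleton; stated for `IsFreePro E.geom Σ` with any `Σ ⊇ {primes}`
(the tree's inhabitants use `Σ = {p | p.Prime}`). [cite: MochizukiAbsTopI2012, Lemma 4.5 (i) p.54] -/
theorem subsingleton_geomH2_of_isFreePro (E : FundamentalExtension.{u}) {S : Set ℕ}
    (hS : ∀ p : ℕ, p.Prime → p ∈ S) (hfree : IsFreePro E.geom S)
    (Λ : Type u) [AddCommGroup Λ] [TopologicalSpace Λ] [IsTopologicalAddGroup Λ] [CompactSpace Λ]
    [TotallyDisconnectedSpace Λ] : Subsingleton (geomH2 E Λ) := by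
  haveI : CompactSpace E.geom := isCompact_iff_compactSpace.mp E.isClosed_geom.isCompact
  exact hfree.subsingleton_continuousCohomology_two_of_primes_subset hS

/-- In particular `H²(Δ_X, Ẑ) = 0` (`Λ = ZHatCoeff`) for free profinite `Δ_X` of finite rank.
[cite: MochizukiAbsTopI2012, Lemma 4.5 (i) p.54] -/
theorem subsingleton_geomH2_zhat_of_isFreePro (E : FundamentalExtension.{u}) {S : Set ℕ}
    (hS : ∀ p : ℕ, p.Prime → p ∈ S) (hfree : IsFreePro E.geom S) :
    Subsingleton (geomH2 E ZHatCoeff.{u}) := by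
  -- `Ẑ = ∏_p ℤ_p` (universe-lifted) is compact (`PadicInt.compactSpace`) and totally disconnected
  -- (ultrametric), transported along `Homeomorph.ulift`
  haveI : TotallyDisconnectedSpace ZHatCoeff.{u} := Homeomorph.ulift.symm.totallyDisconnectedSpace
  exact subsingleton_geomH2_of_isFreePro E hS hfree ZHatCoeff.{u}

namespace CurveModel

variable (M : CurveModel.{u}) {S : Set ℕ} (hS : ∀ p : ℕ, p.Prime → p ∈ S)
include hS

/-- **[AbsTopIII] Prop. 1.4 (ii) — the named fact `Prop_1_4_ii_transgression M` (FACT-LIST F-0338) at the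
printed instance class, with the print's inputs.**  A model ALL of whose cyclotome presentations
`(U_x ⊆ X, x)` have `Δ_{U_x} ↠ Δ_X` (Prop. 1.4 (i)), `I_x ≤ [Δ_{U_x}, Δ_{U_x}]⁻` (one puncture) and `Δ_{U_x}`
FREE PROFINITE of finite rank (`IsFreePro Δ_{U_x} Σ`, any `Σ ⊇ {primes}`; [AbsTopI] Lem. 4.5 (i): `U_x` is
affine) satisfies F-0338 verbatim: the
differential `Hom_cont(Ker(Δ^{c-cn}_{U_x} ↠ Δ_X), Ẑ) → H²(Δ_X, Ẑ)` is bijective for every presentation and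
every section (abc-iut-f-076's `prop_1_4_ii_transgression_of_instanceClass` with its `H²(Δ_{U_x}, Ẑ) = 0`
binder discharged by `subsingleton_geomH2_of_isFreePro`). [cite: MochizukiAbsTopIII2015, Prop 1.4 (ii) p.31] -/
theorem prop_1_4_ii_transgression_of_isFreePro
    (hq : ∀ (Ux X : M.Curve) (h : M.IsCofiniteOpen Ux X) (x : (M.cusps Ux).Cusp),
      M.IsCyclotomePresentation h x → Set.SurjOn (M.res h).arith (M.ext Ux).geom (M.ext X).geom)
    (hI : ∀ (Ux X : M.Curve) (h : M.IsCofiniteOpen Ux X) (x : (M.cusps Ux).Cusp),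
      M.IsCyclotomePresentation h x →
        (M.cusps Ux).Icusp x ≤ (⁅(M.ext Ux).geom, (M.ext Ux).geom⁆).topologicalClosure)
    (hfree : ∀ (Ux X : M.Curve) (h : M.IsCofiniteOpen Ux X) (x : (M.cusps Ux).Cusp),
      M.IsCyclotomePresentation h x → IsFreePro (M.ext Ux).geom S) :
    M.Prop_1_4_ii_transgression :=
  M.prop_1_4_ii_transgression_of_instanceClass hq hI fun Ux X h x hp =>
    subsingleton_geomH2_zhat_of_isFreePro (M.ext Ux) hS (hfree Ux X h x hp)

/-- **F-0338 modulo F-0340 by name**, with `I_x ≤ [Δ_{U_x}, Δ_{U_x}]⁻` and `Δ_{U_x}` free profinite as the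
remaining structural inputs: for a model satisfying the named fact `Prop_1_4_i'` (Prop. 1.4 (i): `Π_U ↠ Π_{U'}`
surjective with bijective Galois part, whence `Δ_{U_x} ↠ Δ_X`, `surjOn_geom_res`), `Prop_1_4_ii_transgression M`
holds. [cite: MochizukiAbsTopIII2015, Prop 1.4 (ii) p.31] -/
theorem prop_1_4_ii_transgression_of_prop_1_4_i'_of_isFreePro (h14 : M.Prop_1_4_i')
    (hI : ∀ (Ux X : M.Curve) (h : M.IsCofiniteOpen Ux X) (x : (M.cusps Ux).Cusp),
      M.IsCyclotomePresentation h x →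
        (M.cusps Ux).Icusp x ≤ (⁅(M.ext Ux).geom, (M.ext Ux).geom⁆).topologicalClosure)
    (hfree : ∀ (Ux X : M.Curve) (h : M.IsCofiniteOpen Ux X) (x : (M.cusps Ux).Cusp),
      M.IsCyclotomePresentation h x → IsFreePro (M.ext Ux).geom S) :
    M.Prop_1_4_ii_transgression :=
  M.prop_1_4_ii_transgression_of_isFreePro hS
    (fun _ _ h _ hp => M.surjOn_geom_res h14 h hp.isScheme.1 hp.isScheme.2) hI hfree

/-- **[AbsTopIII] Prop. 1.4 (ii), `∃`-form — the named fact `Prop_1_4_ii_sync M` (FACT-LIST F-0365) at the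
printed instance class with the print's inputs**: `Δ_{U_x} ↠ Δ_X`, `I_x ≤ [Δ_{U_x}, Δ_{U_x}]⁻`, `Δ_{U_x}` free
profinite (abc-iut-f-082's `prop_1_4_ii_sync_of_surjOn` over `prop_1_4_ii_transgression_of_isFreePro`).
[cite: MochizukiAbsTopIII2015, Prop 1.4 (ii) p.31] -/
theorem prop_1_4_ii_sync_of_isFreePro
    (hq : ∀ (Ux X : M.Curve) (h : M.IsCofiniteOpen Ux X) (x : (M.cusps Ux).Cusp),
      M.IsCyclotomePresentation h x → Set.SurjOn (M.res h).arith (M.ext Ux).geom (M.ext X).geom)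
    (hI : ∀ (Ux X : M.Curve) (h : M.IsCofiniteOpen Ux X) (x : (M.cusps Ux).Cusp),
      M.IsCyclotomePresentation h x →
        (M.cusps Ux).Icusp x ≤ (⁅(M.ext Ux).geom, (M.ext Ux).geom⁆).topologicalClosure)
    (hfree : ∀ (Ux X : M.Curve) (h : M.IsCofiniteOpen Ux X) (x : (M.cusps Ux).Cusp),
      M.IsCyclotomePresentation h x → IsFreePro (M.ext Ux).geom S) :
    M.Prop_1_4_ii_sync :=
  M.prop_1_4_ii_sync_of_surjOn hq (M.prop_1_4_ii_transgression_of_isFreePro hS hq hI hfree)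

/-- **F-0365 modulo F-0340 by name**, remaining inputs `I_x ≤ [Δ_{U_x}, Δ_{U_x}]⁻` and `Δ_{U_x}` free profinite.
[cite: MochizukiAbsTopIII2015, Prop 1.4 (ii) p.31] -/
theorem prop_1_4_ii_sync_of_prop_1_4_i'_of_isFreePro (h14 : M.Prop_1_4_i')
    (hI : ∀ (Ux X : M.Curve) (h : M.IsCofiniteOpen Ux X) (x : (M.cusps Ux).Cusp),
      M.IsCyclotomePresentation h x →
        (M.cusps Ux).Icusp x ≤ (⁅(M.ext Ux).geom, (M.ext Ux).geom⁆).topologicalClosure)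
    (hfree : ∀ (Ux X : M.Curve) (h : M.IsCofiniteOpen Ux X) (x : (M.cusps Ux).Cusp),
      M.IsCyclotomePresentation h x → IsFreePro (M.ext Ux).geom S) :
    M.Prop_1_4_ii_sync :=
  M.prop_1_4_ii_sync_of_isFreePro hS
    (fun _ _ h _ hp => M.surjOn_geom_res h14 h hp.isScheme.1 hp.isScheme.2) hI hfree

end CurveModel

end Literature.AnabelianGeometry.AbsoluteAnabelian.AbsTopIII
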